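import Summits.HodgeConjecture.HodgeConjecture.Theses.NikulinTwinTransport
import Summits.HodgeConjecture.HodgeConjecture.Theorems.NikulinSerreCarrier.Negative.OrientationTwist
import Summits.HodgeConjecture.HodgeConjecture.Theorems.NikulinSerreCarrier.Negative.InvariantCarrierPinned
import Literature.AlgebraicGeometry.Surfaces.K3Surface
import Literature.AlgebraicGeometry.Surfaces.K3NikulinInvolution
import Literature.AlgebraicGeometry.HodgeTheory.AnalytifiedVectorBundle
import Literature.AlgebraicGeometry.HodgeTheory.KaehlerClassHodgeType
import Literature.AlgebraicGeometry.HodgeTheory.ChernCharacterBetti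
import Literature.Geometry.Hyperkaehler.Hyperholomorphic

/-!
# The registered stub `stub_modularTwinAddress` of line `modular-twin-address` is false for every Chern
# character theory (orientation-family twist) — crux `NikulinSerreCarrier`, stmt-HodgeConjecture-14464

Target kill by the standing disprover (cdisprove gen 3).  The stub (registered with the skeleton
`Cruxes/NikulinSerreCarrier/Lines/modular-twin-address.lean`, skeleton sha `b572748113740b24…`; its statement
`Statement.stub_modularTwinAddress`, copied VERBATIM below) has the shape

  `∀ μ : OrientationFamily, μ.HasPoincareDuality → ∀ C : ChernCharacterBetti, ∃ (Nikulin anchor X, Y, N, h, r, Ψ, …)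
     (Mv, 𝓔, g : Y ⟶ Mv, …), … ∧ (∃ m : ℤ, m ≠ 0 ∧ ∀ y, g^*(snd_*^μ(fst^*(Ψ y) ∪ ch₂ 𝓔)) = (−2m) • y)`

— the ADDRESS EQUATION with an INTEGER `m` relative to an ARBITRARY orientation family `μ`.  As for the typed
crux (`Negative/TypedCruxFalse`), at `μ = twistFamily` (`Negative/OrientationTwist`) the Gysin morphism
`snd_*` of `X ⊗ Mv ⟶ Mv` (dimensions `2 + k → k`) is `I •` a rationality-preserving map, so for rational `y`
the address equation reads `I • (rational) = (−2m) • y`, forcing `y = 0` for EVERY rational `y ∈ H²(Y(ℂ); ℂ)`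
(rational classes are real); then `N_j = 0`, `(N₀.N₀) = −2 • pY` gives `pY = 0`, and the generator clause
kills every integral class of `H⁴(Y(ℂ); ℂ)` — impossible for the smooth projective surface `Y`.
Hence: the stub holds for NO `C` at `μ = twistFamily`; it is false outright once `ChernCharacterBetti` is
inhabited, and provable only by proving `ChernCharacterBetti` empty.

CLASSIFICATION: stub-misstated (not substantive) — corrected signature: replace `∃ m : ℤ, m ≠ 0 ∧ … = (-(2 * (m : ℂ))) • y`
by `∃ m : ℂ, m ≠ 0 ∧ … = (-(2 * m)) • y` (scale-invariant; the composition `NikulinSerreCarrier_of` then needs the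
typed crux repaired the same way and `stub_mixedClassTransfer` with `m, m' : ℂ`), or keep `m : ℤ` and restrict `μ`
to rationally normalised families (`ratFamily` shows they exist).  The witness misses both repairs.

## References

* [FultonYoungTableaux1997] W. Fulton, Young Tableaux, CUP 1997, App. B §B.1 (4)–(5).
* [HatcherAT2002] A. Hatcher, Algebraic Topology, CUP 2002, §3.1 Thm. 3.2, §3.3 Thm. 3.26, Thm. 3.30.
* [VoisinHodgeI2002] C. Voisin, Hodge Theory and Complex Algebraic Geometry I, CUP 2002, Cor. 6.12, §7.3.2.
-/

noncomputable section

open scoped Manifold ContDiff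
open CategoryTheory MonoidalCategory
open Literature.AlgebraicGeometry Literature.AlgebraicGeometry.HodgeTheory
open Literature.AlgebraicGeometry.Surfaces Literature.AlgebraicGeometry.Motives
open Literature.AlgebraicTopology.SingularHomology
open Literature.Geometry.Hyperkaehler Literature.Geometry.Kaehler
open Literature.NumberTheory.Transcendental (DeRhamIsoFamily)
open Summit.HodgeConjecture.HodgeConjecture.Theorems.NikulinSerreCarrier.Negative.OrientationTwist

namespace Summit.HodgeConjecture.HodgeConjecture.Theorems.NikulinSerreCarrier.Negative.StubModularTwinAddressFalse

/-- **No Chern character theory admits the address data for the twisted orientation family**: the body of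
`Statement.stub_modularTwinAddress` VERBATIM with `μ := twistFamily`.  For rational `y`, `fst^*(Ψ y) ∪ ch₂ 𝓔` is
rational, `snd_*^{tw}(…) = I • snd_*^{rat}(…)` (`complexGysin_twistFamily_of_two_add`) is `I •` a rational class,
so is its pull-back `g^*`; `= (−2m) • y` with `m ∈ ℤ ∖ 0` forces `y = 0` (`eq_zero_of_I_smul_eq_smul`).  Then
`N₀ = 0`, `pY = 0`, and every integral class of `H⁴(Y(ℂ); ℂ)` vanishes, against
`exists_isIntegralClass_ne_zero_top`. [folklore] -/
theorem stub_modularTwinAddress_twistFamily_false (C : ChernCharacterBetti) :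
    ¬ (
      ∃ (X Y : SchemeOver ℂ) (hX : IsK3Surface X) (hY : IsK3Surface Y)
        (pX : complexBetti X (2 * 2)) (pY : complexBetti Y (2 * 2)) (ι : X ⟶ X)
        (N : Fin 8 → complexBetti Y (2 * 1)) (h : complexBetti Y (2 * 1)) (r : Fin 8 → complexBetti X (2 * 1))
        (Ψ : complexBetti Y (2 * 1) →ₗ[ℂ] complexBetti X (2 * 1)),
        IsNikulinInvolution X ι ∧
        (IsIntegralClass pX ∧ ∀ q : complexBetti X (2 * 2), IsIntegralClass q → ∃ n : ℤ, q = n • pX) ∧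
        (IsIntegralClass pY ∧ ∀ q : complexBetti Y (2 * 2), IsIntegralClass q → ∃ n : ℤ, q = n • pY) ∧
        (∀ j, IsIntegralClass (N j) ∧ N j ∈ algebraicClasses Y 1) ∧
        (∀ i j, cupProduct (rfl : 2 * 1 + 2 * 1 = 2 * 2) (N i) (N j) =
          (if i = j then (-2 : ℂ) else 0) • pY) ∧
        IsIntegralClass ((1 / 2 : ℂ) • ∑ j, N j) ∧
        (IsIntegralClass h ∧ h ∈ algebraicClasses Y 1) ∧
        (∀ j, cupProduct (rfl : 2 * 1 + 2 * 1 = 2 * 2) h (N j) = 0) ∧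
        (∃ d : ℕ, 0 < d ∧ cupProduct (rfl : 2 * 1 + 2 * 1 = 2 * 2) h h = ((2 * d : ℕ) : ℂ) • pY) ∧
        (∀ j, IsIntegralClass (r j) ∧ r j ∈ algebraicClasses X 1 ∧
          complexBetti.map ι (2 * 1) (r j) = -r j) ∧
        (∀ i j, cupProduct (rfl : 2 * 1 + 2 * 1 = 2 * 2) (r i) (r j) =
          (if i = j then (-4 : ℂ) else 0) • pX) ∧
        (∀ x, IsRationalClass x → IsRationalClass (Ψ x)) ∧
        (∀ (i j : ℕ) (x : complexBetti Y (2 * 1)),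
          IsOfHodgeType 2 Y (2 * 1) i j x → IsOfHodgeType 2 X (2 * 1) i j (Ψ x)) ∧
        (∀ (x y : complexBetti Y (2 * 1)) (a : ℂ),
          cupProduct (rfl : 2 * 1 + 2 * 1 = 2 * 2) x y = a • pY →
          cupProduct (rfl : 2 * 1 + 2 * 1 = 2 * 2) (Ψ x) (Ψ y) = ((2 : ℂ) * a) • pX) ∧
        Function.Bijective Ψ ∧
        (∀ j, Ψ (N j) = r j) ∧
        (∀ x : complexBetti Y (2 * 1), (∀ j, cupProduct (rfl : 2 * 1 + 2 * 1 = 2 * 2) x (N j) = 0) →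
          complexBetti.map ι (2 * 1) (Ψ x) = Ψ x) ∧
        (∃ γ₀ ∈ algebraicClasses (X ⊗ Y) 2, ∀ x : complexBetti Y (2 * 1),
          Ψ x = complexGysin twistFamily (IsSmoothProjective.tensor_holds hX.1 hY.1) hX.1
            (SemiCartesianMonoidalCategory.fst X Y)
            (rfl : 2 * 1 + 2 * 2 + 2 * 2 = 2 * 1 + 2 * (2 + 2))
            (cupProduct (rfl : 2 * 1 + 2 * 2 = 2 * 1 + 2 * 2)
              (complexBetti.map (SemiCartesianMonoidalCategory.snd X Y) (2 * 1) x) γ₀)) ∧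
        ∃ ε : Fin 8 → ℝ, (∀ j, 0 < ε j) ∧
        ∃ ω' : complexBetti Y (2 * 1), ω' = h - ∑ j, ((ε j : ℝ) : ℂ) • N j ∧
        ∃ (k : ℕ) (Mv : SchemeOver ℂ) (hMv : IsSmoothProjective k Mv) (𝓔 : (X ⊗ Mv).left.Modules)
          (rk : ℕ) (g : Y ⟶ Mv),
          IsVectorBundle 𝓔 ∧ AlgebraicGeometry.IsClosedImmersion g.left ∧
          (∃ (κI κJ κK : complexBetti Mv (2 * 1)) (αJ αK : complexBetti X (2 * 1)) (c : ℝ), 0 < c ∧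
            (∃ (A : HodgeModel (2 + k) (X ⊗ Mv))
              (𝓕 : AnalytifiedVectorBundle 𝓘(ℂ, A.model) (EuclideanSpace ℂ (Fin rk)) A.toComplexPoints 𝓔)
              (gm : Bundle.ContMDiffRiemannianMetric 𝓘(ℝ, A.model) ∞ A.model
                (fun x : A.carrier ↦ TangentSpace 𝓘(ℝ, A.model) x))
              (J K : ∀ x : A.carrier, TangentSpace 𝓘(ℝ, A.model) x →L[ℝ] TangentSpace 𝓘(ℝ, A.model) x)
              (hHK : IsHyperkaehlerTriple gm.toRiemannianMetric J K)
              (hω : isSmoothForm_kaehlerForm_of_isManifold_complex (E := A.model) (M := A.carrier))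
              (e : DeRhamIsoFamily 𝓘(ℝ, A.model)),
              e.IsNatural ∧
              A.pullback 2
                  (complexBetti.map (SemiCartesianMonoidalCategory.fst X Mv) (2 * 1) (Ψ ω') +
                    complexBetti.map (SemiCartesianMonoidalCategory.snd X Mv) (2 * 1) κI) =
                ofRealClass A.carrier 2 (e A.carrier 2 (gm.kaehlerClass hω hHK.isKaehler)) ∧
              A.pullback 2
                  (complexBetti.map (SemiCartesianMonoidalCategory.fst X Mv) (2 * 1) αJ +
                    complexBetti.map (SemiCartesianMonoidalCategory.snd X Mv) (2 * 1) κJ) =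
                ofRealClass A.carrier 2 (e A.carrier 2 (deRhamCohomology.mk
                  ⟨twoFormOf gm.toRiemannianMetric J, hHK.isSmoothForm_J, hHK.isClosedForm_J⟩)) ∧
              A.pullback 2
                  (complexBetti.map (SemiCartesianMonoidalCategory.fst X Mv) (2 * 1) αK +
                    complexBetti.map (SemiCartesianMonoidalCategory.snd X Mv) (2 * 1) κK) =
                ofRealClass A.carrier 2 (e A.carrier 2 (deRhamCohomology.mk
                  ⟨twoFormOf gm.toRiemannianMetric K, hHK.isSmoothForm_K, hHK.isClosedForm_K⟩)) ∧
              HasHyperholomorphicConnection (EuclideanSpace ℂ (Fin rk)) 𝓕.bundle J K) ∧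
            (cupProduct (rfl : 2 * 1 + 2 * 1 = 2 * 2) (complexBetti.map g (2 * 1) κI) (complexBetti.map g (2 * 1) κI) = ((c : ℝ) : ℂ) • pY ∧
            cupProduct (rfl : 2 * 1 + 2 * 1 = 2 * 2) (complexBetti.map g (2 * 1) κJ) (complexBetti.map g (2 * 1) κJ) = ((c : ℝ) : ℂ) • pY ∧
            cupProduct (rfl : 2 * 1 + 2 * 1 = 2 * 2) (complexBetti.map g (2 * 1) κK) (complexBetti.map g (2 * 1) κK) = ((c : ℝ) : ℂ) • pY ∧
            cupProduct (rfl : 2 * 1 + 2 * 1 = 2 * 2) (complexBetti.map g (2 * 1) κI) (complexBetti.map g (2 * 1) κJ) = 0 ∧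
            cupProduct (rfl : 2 * 1 + 2 * 1 = 2 * 2) (complexBetti.map g (2 * 1) κI) (complexBetti.map g (2 * 1) κK) = 0 ∧
            cupProduct (rfl : 2 * 1 + 2 * 1 = 2 * 2) (complexBetti.map g (2 * 1) κJ) (complexBetti.map g (2 * 1) κK) = 0) ∧
            complexBetti.map g (2 * 1) κI = ω') ∧
          C.ch (X ⊗ Y) ((AlgebraicGeometry.Scheme.Modules.pullback (X ◁ g).left).obj 𝓔) 1 = 0 ∧
          (∃ m : ℤ, m ≠ 0 ∧ ∀ y : complexBetti Y (2 * 1),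
            complexBetti.map g (2 * 1)
              (complexGysin twistFamily (IsSmoothProjective.tensor_holds hX.1 hMv) hMv
                (SemiCartesianMonoidalCategory.snd X Mv)
                (by omega : 2 * 3 + 2 * k = 2 * 1 + 2 * (2 + k))
                (cupProduct (rfl : 2 * 1 + 2 * 2 = 2 * 3)
                  (complexBetti.map (SemiCartesianMonoidalCategory.fst X Mv) (2 * 1) (Ψ y))
                  (C.ch (X ⊗ Mv) 𝓔 2))) =
            (-(2 * (m : ℂ))) • y)) := by
  rintro ⟨X, Y, hX, hY, pX, pY, ι, N, h, r, Ψ, -, -, hpY, hN, hNN, -, -, -, -, -, -, hΨrat,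
      -, -, -, -, -, -, ε, -, ω', -, k, Mv, hMv, 𝓔, rk, g, hE, -, -, -, m, hm, haddr⟩
  -- Step 1: every rational class of `H²(Y(ℂ); ℂ)` vanishes.
  have key : ∀ y : complexBetti Y (2 * 1), IsRationalClass y → y = 0 := by
    intro y hy
    have hw : IsRationalClass (cupProduct (rfl : 2 * 1 + 2 * 2 = 2 * 3)
        (complexBetti.map (SemiCartesianMonoidalCategory.fst X Mv) (2 * 1) (Ψ y)) (C.ch (X ⊗ Mv) 𝓔 2)) :=
      ((hΨrat y hy).map _).cup _ (C.isRationalClass_ch _ 𝓔 hE 2)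
    have e := haddr y
    rw [complexGysin_twistFamily_of_two_add, LinearMap.smul_apply, map_smul] at e
    refine eq_zero_of_I_smul_eq_smul ((isRationalClass_complexGysin_ratFamily _ _ _ _ hw).map _) hy
      (r := -(2 * (m : ℂ))) (by rw [map_neg, map_mul, map_intCast, map_ofNat]) ?_ e
    exact neg_ne_zero.2 (mul_ne_zero two_ne_zero (Int.cast_ne_zero.2 hm))
  -- Step 2: `N₀ = 0`, hence `pY = 0`.
  have hpY0 : pY = 0 := by
    have e := hNN 0 0
    rw [key _ (hN 0).1.isRationalClass, map_zero] at e
    simp only [if_true] at e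
    exact (smul_eq_zero.1 e.symm).resolve_left (by norm_num)
  -- Step 3: every integral class of `H⁴(Y(ℂ); ℂ)` would vanish.
  obtain ⟨q, hq, hq0⟩ := exists_isIntegralClass_ne_zero_top hY.1
  obtain ⟨n, hn⟩ := hpY.2 q hq
  exact hq0 (by rw [hn, hpY0, smul_zero])

/-- **`stub_modularTwinAddress` is false as soon as one Chern character theory on the real carrier exists**
(statement VERBATIM = `Statement.stub_modularTwinAddress` of the registered skeleton, identified by `rfl` in any
file elaborating both).  Negative lemma modulo `H := Nonempty ChernCharacterBetti`; class stub-misstated, corrected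
signature in the module docstring (`m : ℂ`). [cite: Fulton1998, Example 3.2.3] -/
theorem stub_modularTwinAddress_false_of_nonempty_chernCharacterBetti (hC : Nonempty ChernCharacterBetti) :
    ¬ (
    ∀ (μ : OrientationFamily), μ.HasPoincareDuality → ∀ (C : ChernCharacterBetti),
      ∃ (X Y : SchemeOver ℂ) (hX : IsK3Surface X) (hY : IsK3Surface Y)
        (pX : complexBetti X (2 * 2)) (pY : complexBetti Y (2 * 2)) (ι : X ⟶ X)
        (N : Fin 8 → complexBetti Y (2 * 1)) (h : complexBetti Y (2 * 1)) (r : Fin 8 → complexBetti X (2 * 1))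
        (Ψ : complexBetti Y (2 * 1) →ₗ[ℂ] complexBetti X (2 * 1)),
        IsNikulinInvolution X ι ∧
        (IsIntegralClass pX ∧ ∀ q : complexBetti X (2 * 2), IsIntegralClass q → ∃ n : ℤ, q = n • pX) ∧
        (IsIntegralClass pY ∧ ∀ q : complexBetti Y (2 * 2), IsIntegralClass q → ∃ n : ℤ, q = n • pY) ∧
        (∀ j, IsIntegralClass (N j) ∧ N j ∈ algebraicClasses Y 1) ∧
        (∀ i j, cupProduct (rfl : 2 * 1 + 2 * 1 = 2 * 2) (N i) (N j) =
          (if i = j then (-2 : ℂ) else 0) • pY) ∧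
        IsIntegralClass ((1 / 2 : ℂ) • ∑ j, N j) ∧
        (IsIntegralClass h ∧ h ∈ algebraicClasses Y 1) ∧
        (∀ j, cupProduct (rfl : 2 * 1 + 2 * 1 = 2 * 2) h (N j) = 0) ∧
        (∃ d : ℕ, 0 < d ∧ cupProduct (rfl : 2 * 1 + 2 * 1 = 2 * 2) h h = ((2 * d : ℕ) : ℂ) • pY) ∧
        (∀ j, IsIntegralClass (r j) ∧ r j ∈ algebraicClasses X 1 ∧
          complexBetti.map ι (2 * 1) (r j) = -r j) ∧
        (∀ i j, cupProduct (rfl : 2 * 1 + 2 * 1 = 2 * 2) (r i) (r j) =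
          (if i = j then (-4 : ℂ) else 0) • pX) ∧
        (∀ x, IsRationalClass x → IsRationalClass (Ψ x)) ∧
        (∀ (i j : ℕ) (x : complexBetti Y (2 * 1)),
          IsOfHodgeType 2 Y (2 * 1) i j x → IsOfHodgeType 2 X (2 * 1) i j (Ψ x)) ∧
        (∀ (x y : complexBetti Y (2 * 1)) (a : ℂ),
          cupProduct (rfl : 2 * 1 + 2 * 1 = 2 * 2) x y = a • pY →
          cupProduct (rfl : 2 * 1 + 2 * 1 = 2 * 2) (Ψ x) (Ψ y) = ((2 : ℂ) * a) • pX) ∧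
        Function.Bijective Ψ ∧
        (∀ j, Ψ (N j) = r j) ∧
        (∀ x : complexBetti Y (2 * 1), (∀ j, cupProduct (rfl : 2 * 1 + 2 * 1 = 2 * 2) x (N j) = 0) →
          complexBetti.map ι (2 * 1) (Ψ x) = Ψ x) ∧
        (∃ γ₀ ∈ algebraicClasses (X ⊗ Y) 2, ∀ x : complexBetti Y (2 * 1),
          Ψ x = complexGysin μ (IsSmoothProjective.tensor_holds hX.1 hY.1) hX.1
            (SemiCartesianMonoidalCategory.fst X Y)
            (rfl : 2 * 1 + 2 * 2 + 2 * 2 = 2 * 1 + 2 * (2 + 2))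
            (cupProduct (rfl : 2 * 1 + 2 * 2 = 2 * 1 + 2 * 2)
              (complexBetti.map (SemiCartesianMonoidalCategory.snd X Y) (2 * 1) x) γ₀)) ∧
        ∃ ε : Fin 8 → ℝ, (∀ j, 0 < ε j) ∧
        ∃ ω' : complexBetti Y (2 * 1), ω' = h - ∑ j, ((ε j : ℝ) : ℂ) • N j ∧
        ∃ (k : ℕ) (Mv : SchemeOver ℂ) (hMv : IsSmoothProjective k Mv) (𝓔 : (X ⊗ Mv).left.Modules)
          (rk : ℕ) (g : Y ⟶ Mv),
          IsVectorBundle 𝓔 ∧ AlgebraicGeometry.IsClosedImmersion g.left ∧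
          (∃ (κI κJ κK : complexBetti Mv (2 * 1)) (αJ αK : complexBetti X (2 * 1)) (c : ℝ), 0 < c ∧
            (∃ (A : HodgeModel (2 + k) (X ⊗ Mv))
              (𝓕 : AnalytifiedVectorBundle 𝓘(ℂ, A.model) (EuclideanSpace ℂ (Fin rk)) A.toComplexPoints 𝓔)
              (gm : Bundle.ContMDiffRiemannianMetric 𝓘(ℝ, A.model) ∞ A.model
                (fun x : A.carrier ↦ TangentSpace 𝓘(ℝ, A.model) x))
              (J K : ∀ x : A.carrier, TangentSpace 𝓘(ℝ, A.model) x →L[ℝ] TangentSpace 𝓘(ℝ, A.model) x)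
              (hHK : IsHyperkaehlerTriple gm.toRiemannianMetric J K)
              (hω : isSmoothForm_kaehlerForm_of_isManifold_complex (E := A.model) (M := A.carrier))
              (e : DeRhamIsoFamily 𝓘(ℝ, A.model)),
              e.IsNatural ∧
              A.pullback 2
                  (complexBetti.map (SemiCartesianMonoidalCategory.fst X Mv) (2 * 1) (Ψ ω') +
                    complexBetti.map (SemiCartesianMonoidalCategory.snd X Mv) (2 * 1) κI) =
                ofRealClass A.carrier 2 (e A.carrier 2 (gm.kaehlerClass hω hHK.isKaehler)) ∧
              A.pullback 2
                  (complexBetti.map (SemiCartesianMonoidalCategory.fst X Mv) (2 * 1) αJ +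
                    complexBetti.map (SemiCartesianMonoidalCategory.snd X Mv) (2 * 1) κJ) =
                ofRealClass A.carrier 2 (e A.carrier 2 (deRhamCohomology.mk
                  ⟨twoFormOf gm.toRiemannianMetric J, hHK.isSmoothForm_J, hHK.isClosedForm_J⟩)) ∧
              A.pullback 2
                  (complexBetti.map (SemiCartesianMonoidalCategory.fst X Mv) (2 * 1) αK +
                    complexBetti.map (SemiCartesianMonoidalCategory.snd X Mv) (2 * 1) κK) =
                ofRealClass A.carrier 2 (e A.carrier 2 (deRhamCohomology.mk
                  ⟨twoFormOf gm.toRiemannianMetric K, hHK.isSmoothForm_K, hHK.isClosedForm_K⟩)) ∧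
              HasHyperholomorphicConnection (EuclideanSpace ℂ (Fin rk)) 𝓕.bundle J K) ∧
            (cupProduct (rfl : 2 * 1 + 2 * 1 = 2 * 2) (complexBetti.map g (2 * 1) κI) (complexBetti.map g (2 * 1) κI) = ((c : ℝ) : ℂ) • pY ∧
            cupProduct (rfl : 2 * 1 + 2 * 1 = 2 * 2) (complexBetti.map g (2 * 1) κJ) (complexBetti.map g (2 * 1) κJ) = ((c : ℝ) : ℂ) • pY ∧
            cupProduct (rfl : 2 * 1 + 2 * 1 = 2 * 2) (complexBetti.map g (2 * 1) κK) (complexBetti.map g (2 * 1) κK) = ((c : ℝ) : ℂ) • pY ∧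
            cupProduct (rfl : 2 * 1 + 2 * 1 = 2 * 2) (complexBetti.map g (2 * 1) κI) (complexBetti.map g (2 * 1) κJ) = 0 ∧
            cupProduct (rfl : 2 * 1 + 2 * 1 = 2 * 2) (complexBetti.map g (2 * 1) κI) (complexBetti.map g (2 * 1) κK) = 0 ∧
            cupProduct (rfl : 2 * 1 + 2 * 1 = 2 * 2) (complexBetti.map g (2 * 1) κJ) (complexBetti.map g (2 * 1) κK) = 0) ∧
            complexBetti.map g (2 * 1) κI = ω') ∧
          C.ch (X ⊗ Y) ((AlgebraicGeometry.Scheme.Modules.pullback (X ◁ g).left).obj 𝓔) 1 = 0 ∧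
          (∃ m : ℤ, m ≠ 0 ∧ ∀ y : complexBetti Y (2 * 1),
            complexBetti.map g (2 * 1)
              (complexGysin μ (IsSmoothProjective.tensor_holds hX.1 hMv) hMv
                (SemiCartesianMonoidalCategory.snd X Mv)
                (by omega : 2 * 3 + 2 * k = 2 * 1 + 2 * (2 + k))
                (cupProduct (rfl : 2 * 1 + 2 * 2 = 2 * 3)
                  (complexBetti.map (SemiCartesianMonoidalCategory.fst X Mv) (2 * 1) (Ψ y))
                  (C.ch (X ⊗ Mv) 𝓔 2))) =
            (-(2 * (m : ℂ))) • y)) := fun H ↦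
  stub_modularTwinAddress_twistFamily_false hC.some (H twistFamily (OrientationFamily.hasPoincareDuality _) hC.some)

/-- Equivalently: the stub can only hold vacuously — it implies that no Chern character theory with values in
`H²*(–(ℂ); ℂ)` exists. [folklore] -/
theorem isEmpty_chernCharacterBetti_of_stub_modularTwinAddress (H :
    ∀ (μ : OrientationFamily), μ.HasPoincareDuality → ∀ (C : ChernCharacterBetti),
      ∃ (X Y : SchemeOver ℂ) (hX : IsK3Surface X) (hY : IsK3Surface Y)
        (pX : complexBetti X (2 * 2)) (pY : complexBetti Y (2 * 2)) (ι : X ⟶ X)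
        (N : Fin 8 → complexBetti Y (2 * 1)) (h : complexBetti Y (2 * 1)) (r : Fin 8 → complexBetti X (2 * 1))
        (Ψ : complexBetti Y (2 * 1) →ₗ[ℂ] complexBetti X (2 * 1)),
        IsNikulinInvolution X ι ∧
        (IsIntegralClass pX ∧ ∀ q : complexBetti X (2 * 2), IsIntegralClass q → ∃ n : ℤ, q = n • pX) ∧
        (IsIntegralClass pY ∧ ∀ q : complexBetti Y (2 * 2), IsIntegralClass q → ∃ n : ℤ, q = n • pY) ∧
        (∀ j, IsIntegralClass (N j) ∧ N j ∈ algebraicClasses Y 1) ∧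
        (∀ i j, cupProduct (rfl : 2 * 1 + 2 * 1 = 2 * 2) (N i) (N j) =
          (if i = j then (-2 : ℂ) else 0) • pY) ∧
        IsIntegralClass ((1 / 2 : ℂ) • ∑ j, N j) ∧
        (IsIntegralClass h ∧ h ∈ algebraicClasses Y 1) ∧
        (∀ j, cupProduct (rfl : 2 * 1 + 2 * 1 = 2 * 2) h (N j) = 0) ∧
        (∃ d : ℕ, 0 < d ∧ cupProduct (rfl : 2 * 1 + 2 * 1 = 2 * 2) h h = ((2 * d : ℕ) : ℂ) • pY) ∧
        (∀ j, IsIntegralClass (r j) ∧ r j ∈ algebraicClasses X 1 ∧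
          complexBetti.map ι (2 * 1) (r j) = -r j) ∧
        (∀ i j, cupProduct (rfl : 2 * 1 + 2 * 1 = 2 * 2) (r i) (r j) =
          (if i = j then (-4 : ℂ) else 0) • pX) ∧
        (∀ x, IsRationalClass x → IsRationalClass (Ψ x)) ∧
        (∀ (i j : ℕ) (x : complexBetti Y (2 * 1)),
          IsOfHodgeType 2 Y (2 * 1) i j x → IsOfHodgeType 2 X (2 * 1) i j (Ψ x)) ∧
        (∀ (x y : complexBetti Y (2 * 1)) (a : ℂ),
          cupProduct (rfl : 2 * 1 + 2 * 1 = 2 * 2) x y = a • pY →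
          cupProduct (rfl : 2 * 1 + 2 * 1 = 2 * 2) (Ψ x) (Ψ y) = ((2 : ℂ) * a) • pX) ∧
        Function.Bijective Ψ ∧
        (∀ j, Ψ (N j) = r j) ∧
        (∀ x : complexBetti Y (2 * 1), (∀ j, cupProduct (rfl : 2 * 1 + 2 * 1 = 2 * 2) x (N j) = 0) →
          complexBetti.map ι (2 * 1) (Ψ x) = Ψ x) ∧
        (∃ γ₀ ∈ algebraicClasses (X ⊗ Y) 2, ∀ x : complexBetti Y (2 * 1),
          Ψ x = complexGysin μ (IsSmoothProjective.tensor_holds hX.1 hY.1) hX.1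
            (SemiCartesianMonoidalCategory.fst X Y)
            (rfl : 2 * 1 + 2 * 2 + 2 * 2 = 2 * 1 + 2 * (2 + 2))
            (cupProduct (rfl : 2 * 1 + 2 * 2 = 2 * 1 + 2 * 2)
              (complexBetti.map (SemiCartesianMonoidalCategory.snd X Y) (2 * 1) x) γ₀)) ∧
        ∃ ε : Fin 8 → ℝ, (∀ j, 0 < ε j) ∧
        ∃ ω' : complexBetti Y (2 * 1), ω' = h - ∑ j, ((ε j : ℝ) : ℂ) • N j ∧
        ∃ (k : ℕ) (Mv : SchemeOver ℂ) (hMv : IsSmoothProjective k Mv) (𝓔 : (X ⊗ Mv).left.Modules)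
          (rk : ℕ) (g : Y ⟶ Mv),
          IsVectorBundle 𝓔 ∧ AlgebraicGeometry.IsClosedImmersion g.left ∧
          (∃ (κI κJ κK : complexBetti Mv (2 * 1)) (αJ αK : complexBetti X (2 * 1)) (c : ℝ), 0 < c ∧
            (∃ (A : HodgeModel (2 + k) (X ⊗ Mv))
              (𝓕 : AnalytifiedVectorBundle 𝓘(ℂ, A.model) (EuclideanSpace ℂ (Fin rk)) A.toComplexPoints 𝓔)
              (gm : Bundle.ContMDiffRiemannianMetric 𝓘(ℝ, A.model) ∞ A.model
                (fun x : A.carrier ↦ TangentSpace 𝓘(ℝ, A.model) x))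
              (J K : ∀ x : A.carrier, TangentSpace 𝓘(ℝ, A.model) x →L[ℝ] TangentSpace 𝓘(ℝ, A.model) x)
              (hHK : IsHyperkaehlerTriple gm.toRiemannianMetric J K)
              (hω : isSmoothForm_kaehlerForm_of_isManifold_complex (E := A.model) (M := A.carrier))
              (e : DeRhamIsoFamily 𝓘(ℝ, A.model)),
              e.IsNatural ∧
              A.pullback 2
                  (complexBetti.map (SemiCartesianMonoidalCategory.fst X Mv) (2 * 1) (Ψ ω') +
                    complexBetti.map (SemiCartesianMonoidalCategory.snd X Mv) (2 * 1) κI) =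
                ofRealClass A.carrier 2 (e A.carrier 2 (gm.kaehlerClass hω hHK.isKaehler)) ∧
              A.pullback 2
                  (complexBetti.map (SemiCartesianMonoidalCategory.fst X Mv) (2 * 1) αJ +
                    complexBetti.map (SemiCartesianMonoidalCategory.snd X Mv) (2 * 1) κJ) =
                ofRealClass A.carrier 2 (e A.carrier 2 (deRhamCohomology.mk
                  ⟨twoFormOf gm.toRiemannianMetric J, hHK.isSmoothForm_J, hHK.isClosedForm_J⟩)) ∧
              A.pullback 2
                  (complexBetti.map (SemiCartesianMonoidalCategory.fst X Mv) (2 * 1) αK +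
                    complexBetti.map (SemiCartesianMonoidalCategory.snd X Mv) (2 * 1) κK) =
                ofRealClass A.carrier 2 (e A.carrier 2 (deRhamCohomology.mk
                  ⟨twoFormOf gm.toRiemannianMetric K, hHK.isSmoothForm_K, hHK.isClosedForm_K⟩)) ∧
              HasHyperholomorphicConnection (EuclideanSpace ℂ (Fin rk)) 𝓕.bundle J K) ∧
            (cupProduct (rfl : 2 * 1 + 2 * 1 = 2 * 2) (complexBetti.map g (2 * 1) κI) (complexBetti.map g (2 * 1) κI) = ((c : ℝ) : ℂ) • pY ∧
            cupProduct (rfl : 2 * 1 + 2 * 1 = 2 * 2) (complexBetti.map g (2 * 1) κJ) (complexBetti.map g (2 * 1) κJ) = ((c : ℝ) : ℂ) • pY ∧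
            cupProduct (rfl : 2 * 1 + 2 * 1 = 2 * 2) (complexBetti.map g (2 * 1) κK) (complexBetti.map g (2 * 1) κK) = ((c : ℝ) : ℂ) • pY ∧
            cupProduct (rfl : 2 * 1 + 2 * 1 = 2 * 2) (complexBetti.map g (2 * 1) κI) (complexBetti.map g (2 * 1) κJ) = 0 ∧
            cupProduct (rfl : 2 * 1 + 2 * 1 = 2 * 2) (complexBetti.map g (2 * 1) κI) (complexBetti.map g (2 * 1) κK) = 0 ∧
            cupProduct (rfl : 2 * 1 + 2 * 1 = 2 * 2) (complexBetti.map g (2 * 1) κJ) (complexBetti.map g (2 * 1) κK) = 0) ∧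
            complexBetti.map g (2 * 1) κI = ω') ∧
          C.ch (X ⊗ Y) ((AlgebraicGeometry.Scheme.Modules.pullback (X ◁ g).left).obj 𝓔) 1 = 0 ∧
          (∃ m : ℤ, m ≠ 0 ∧ ∀ y : complexBetti Y (2 * 1),
            complexBetti.map g (2 * 1)
              (complexGysin μ (IsSmoothProjective.tensor_holds hX.1 hMv) hMv
                (SemiCartesianMonoidalCategory.snd X Mv)
                (by omega : 2 * 3 + 2 * k = 2 * 1 + 2 * (2 + k))
                (cupProduct (rfl : 2 * 1 + 2 * 2 = 2 * 3)
                  (complexBetti.map (SemiCartesianMonoidalCategory.fst X Mv) (2 * 1) (Ψ y))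
                  (C.ch (X ⊗ Mv) 𝓔 2))) =
            (-(2 * (m : ℂ))) • y)) :
    IsEmpty ChernCharacterBetti :=
  ⟨fun C ↦ stub_modularTwinAddress_twistFamily_false C
    (H twistFamily (OrientationFamily.hasPoincareDuality _) C)⟩

end Summit.HodgeConjecture.HodgeConjecture.Theorems.NikulinSerreCarrier.Negative.StubModularTwinAddressFalse

end
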